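import Literature.MathematicalPhysics.QuantumLattice.TypeClassSidecarReaderUBox
import Literature.MathematicalPhysics.QuantumLattice.HubbardTorusMarkovStairWindow
import HarnessLib

/-!
# «c2-sector» sidecar readers on a `U`-CELL: the sidecar at the RIGHT end, a corner Markov (C1) certificate at the
# LEFT end, both edges of the cell at ZERO transport price

Family `hubbard` (topic `MathematicalPhysics/QuantumLattice`), seat hubbard-downfold-unc-1 (stage S1 → S2 of the Hubbard
material-oracle programme: «a parameter BOX maps to a certified word», the `U` direction). `TypeClassSidecarReaderUBox`
worded a checked «c2-sector» sidecar (`c2Check … = true` + its claim node at `U₀`) on the half-line `U ≤ U₀` (C2-only cap,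
free) and priced it above `U₀`; its §8 put BOTH certificates of a hubbard-thermal fixed-point cell (C2 at `(β, U₀)`, C1 at
`(β_h, U₀)`) on a `U`-interval at kinematic / docc-word prices. `HubbardTTPrimePressureFloorUTransport` §6 proved that the
CROSS-CORNER placement is free: a pressure FLOOR at the RIGHT end `U₂` moves down in `U` and a pressure CEILING at the LEFT
end `U₁` moves up in `U` at no price (`…_of_pressure_bounds_UCell`, both edges), and gave the certificate edition in the raw
type-class currency (`S, m, z`). This file states the cross-corner cell in the currency the producers actually land —
the checked sidecar (`c2Check P K q A₀ a b rows Wnum Wden = true`, density `n (q a b) = 2A₀`, claim node at `(β, U₂)`) and a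
CORNER Markov certificate (window `Λ` with lexicographically largest corner `x₀`, `x₀ − eᵢ ∈ Λ`, structured annihilator,
Hermitian dual `L_B` on the shield `Λ ∖ x₀`, constant `c`) at the left end `U₁`:

* §1 generic corner window, `t' = 0`: the UPPER edge `e_Φ(ω) ≤ ((c − β_h μ n) − Wnum/Wden)/(β − β_h)` for every torus limit of
  the canonical sector Gibbs states at `(β, t, 0, U, n)`, every `U ∈ [U₁, U₂]`, from C2 at `(β, U₂)` and C1 at `(β_h, μ, U₁)`,
  `0 < β_h < β` (`…le_of_c2Check_right_of_cornerMarkovCertificate_left_UCell_allTori`); the LOWER edge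
  `(Wnum/Wden − (c − β_c μ n))/(β_c − β) ≤ e_Φ(ω)` from C2 at `(β, U₂)` and C1 at a colder `(β_c, μ, U₁)`, `β < β_c`
  (`…le_meanEnergy…_of_c2Check_right_of_cornerMarkovCertificate_left_UCell_allTori`);
* §2 the RECTANGLE corollaries (`Λ = rectWindow a' b'`, corner `(a'−1, b'−1)`, `a', b' ≥ 2` — hubbard-thermal-eng-2's `3 × 2`
  shields) and §3 the STAIRCASE corollaries (`Λ = stairWindow lo₁ hi₁ lo₀ hi₀`, corner `(1, hi₁−1)` — the `stair:2,2,1` 7-site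
  shield), both edges; the ONE-ANCHOR case is `U₁ = U₂` (§3 prints it for staircases: `…_of_c2Check_of_stairMarkovCertificate_allTori`,
  the reader a C2 floor at `β` + a staircase C1 at `β_h` lacked);
* §4 `t' ≠ 0`: the `t–t'` rectangle C1 (`cornerEnergyRepTT'`) at the left end and the sidecar at the right end, both edges
  (`…_of_c2Check_right_of_rectMarkovCertificateTT'_left_UCell_allTori`), composing `HubbardTTPrimePressureFloorUTransport` §8.

So a sidecar certified at the RIGHT `U`-end of a material box and a C1 certificate at its LEFT `U`-end word the whole `U`-face
with BOTH certificates and NO transport price, at every temperature the pair certifies — the production geometry this seat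
asked hubbard-thermal for (sidecars at `U = 17/2`, `t' = −1/4`, and `U = 9`, `t' = 0`, kit j272908 / j272909).

Everything is PROVED; no definition, no named fact, no number. HONEST SCOPE: transport in `U` only (antitonicity of the
canonical pressure in a positive coupling); nothing moves in `β` or `t'` here; the edges are exactly the fixed-point chords
with the two inputs read at opposite ends. WHAT THIS IS NOT: no certificate, no phase sentence.

## Mathlib / tree search

REUSED: `IsTorusLimitOfMixture.meanEnergy_hubbardTTPrime_le_of_pressure_bounds_UCell`, `…le_meanEnergy…_of_pressure_bounds_UCell`,
`…_of_typeClass_right_of_rectMarkovCertificateTT'_left_UCell_allTori` (both edges), `density_nonneg_of_type`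
(`HubbardTTPrimePressureFloorUTransport` §6, §8); `eventually_pressureFloor_of_c2Check_of_le_U` (`TypeClassSidecarReaderUBox` §2);
`c2Check_sound`, `c2Floor_le_of_rows`, `c2Sectors`, `c2Type` (`TypeClassSidecarReader`);
`eventually_log_partitionFn_sectorHamiltonianTT'_le_of_clusterCertificate` (`HubbardTorusMarkovClusterPressureTorusLimit`);
`bondWeightSum_cornerBondWeight`, `siteWeightSum_cornerSiteWeight`, `siteWeightSum_mul_cornerSiteWeight`, `hubbardTorusTT'_zero_sub_mu`
(`HubbardTorusMarkovPressureClusterBound`); `isHermitian_windowAnnihilator`, `trace_window_mul_windowAnnihilator`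
(`HubbardTorusClusterEnergyRepresentative`); `relabel_translate_gibbsDensity`, `relabel_translate_hubbardTorusWith`;
`rectCorner_mem_rectWindow`, `toLex_le_toLex_rectCorner`, `rectCorner_sub_unitVec_mem_rectWindow`, `rectWindow_subset_halfOpenBox_max`
(`HubbardTorusMarkovRectWindow`); `stairCorner_mem_stairWindow`, `toLex_le_toLex_stairCorner`, `stairCorner_sub_unitVec_mem_stairWindow`,
`stairWindow_subset_halfOpenBox` (`HubbardTorusMarkovStairWindow`). `rg 'c2Check_right|c2Check_of_stair|cornerMarkovCertificate_left'
Literature/MathematicalPhysics/QuantumLattice` (2026-08-27): nothing.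

## References

* R. B. Israel, *Convexity in the Theory of Lattice Gases* (1979), Thm. I.3.4 (monotonicity of the pressure in a positive
  coupling), Lemma II.3.1 (energy–pressure chords). [cite: Israel1979, Thm. I.3.4] [cite: Israel1979, Lemma II.3.1]
* D. Poulin, M. B. Hastings, Phys. Rev. Lett. 106 (2011) 080403, eqs. (3)–(8) (Markov / cluster certificate bound on the
  free energy). [cite: PoulinHastings2011, eqs. (3)–(8)]
* D. Ruelle, *Statistical Mechanics: Rigorous Results* (1969), §3.3–3.4. [cite: Ruelle1969, §3.3]
* T. M. Cover, J. A. Thomas, *Elements of Information Theory* (2006), Theorem 11.1.3 (method of types). [cite: CoverThomas2006, Theorem 11.1.3]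
-/

noncomputable section

namespace Literature.MathematicalPhysics.QuantumLattice

open Matrix Finset HubbardWave0 ThermodynamicLimit LiebThm1 AndersonCluster Literature.Probability.LatticeModels
open _root_.Filter
open scoped _root_.Topology ComplexOrder BigOperators

namespace InfVolFermionState

variable {t t' U n β : ℝ} {ω : InfVolFermionState 2} {Ls : ℕ → ℕ}

/-! ### §1 Generic corner window, `t' = 0`: C2 sidecar at the right end, corner Markov C1 at the left end -/

/-- **UPPER edge on a whole `U`-cell from a checked «c2-sector» sidecar at the RIGHT end and a corner Markov (C1)
certificate at the LEFT end, every torus limit, NO transport price** (`t' = 0`, `n ≤ 2`, `U ∈ [U₁, U₂]`, `0 < β_h < β`).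
C2 at `(β, t, 0, U₂)`: open `a × b` box, rows passing `c2Check P K q A₀ a b rows Wnum Wden`, density `n (q a b) = 2 A₀`, claim
node `∀ r ∈ rows, zn_r/2^ze_r ≤ Re Z_β(H^open_{a×b}(t,0,U₂); N↑_r, N↓_r)`. C1 at `(β_h, μ, U₁)`: window `Λ ⊆ [0, ℓ_w)²` with corner
`x₀` (lexicographically largest, `x₀ − eᵢ ∈ Λ`), structured annihilator `G`, Hermitian dual `L_B ∈ 𝔄_{Λ∖x₀}`, constant `c` with
`e^c · exp(L_B) − tr_{x₀} exp(−β_h (h_μ + G) + Γ L_B) ⪰ 0`, `h_μ = cornerEnergyRep Λ x₀ t U₁ μ`. Then for every torus limit `ω` of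
the canonical sector Gibbs states of `H(t,0,U)` at `β` along any `Ls → ∞`:
`e_Φ(ω) ≤ ((c − β_h μ n) − Wnum/Wden)/(β − β_h)` — the floor moves down and the ceiling up in `U` for free.
[cite: Israel1979, Lemma II.3.1] [cite: Israel1979, Thm. I.3.4] [cite: PoulinHastings2011, eqs. (3)–(8)] [cite: Ruelle1969, §3.3] -/
theorem IsTorusLimitOfMixture.meanEnergy_hubbardTTPrime_le_of_c2Check_right_of_cornerMarkovCertificate_left_UCell_allTori
    (hn2 : n ≤ 2) {U₁ U₂ : ℝ} (hU : U ∈ Set.Icc U₁ U₂)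
    (h : ω.IsTorusLimitOfMixture (sectorGibbsCount n) (fun L => sectorGibbsWeightTT' β t 0 U n L)
      (fun L => sectorGibbsVectorTT' t 0 U n L) Ls)
    (hLs : Tendsto Ls atTop atTop) {βh : ℝ} (hβh : 0 < βh) (hlt : βh < β)
    -- C2 at `(β, U₂)`
    {a b : ℕ} (ha : 1 ≤ a) (hb : 1 ≤ b) {rows : List C2Row} {P K q A₀ : ℕ} {Wnum : ℤ} {Wden : ℕ}
    (hcheck : c2Check P K q A₀ a b rows Wnum Wden = true) (hn : n * ((q : ℝ) * a * b) = 2 * A₀)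
    (hnode : ∀ r ∈ rows,
      r.floor ≤ (partitionFn β (spinSectorHamiltonian r.nu r.nd (hubbardOpenBoxTT' a b t 0 U₂))).re)
    -- C1 (corner window) at `(βh, μ, U₁)`
    (μ : ℝ) {Λ : Finset (Site 2)} {x₀ : Site 2} (hx₀ : x₀ ∈ Λ) (hmax : ∀ y ∈ Λ, toLex y ≤ toLex x₀)
    (hcorner : ∀ i : Fin 2, x₀ - unitVec i ∈ Λ) {ℓw : ℕ} (hΛ : Λ ⊆ halfOpenBox 2 ℓw)
    {ι : Type*} (sι : Finset ι) (Sw : ι → Finset (Site 2)) (hS : ∀ i, Sw i ⊆ Λ) (zw : ι → Site 2)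
    (hzw : ∀ i, shiftSet (zw i) (Sw i) ⊆ Λ) {O : ∀ i, FermionOp (Sw i)} (hO : ∀ i ∈ sι, (O i).IsHermitian)
    (g : ι → ℝ) {LB : FermionOp (Λ.erase x₀)} (hLB : LB.IsHermitian) {c : ℝ}
    (hcert : ((Real.exp c : ℂ) • cfc Real.exp LB -
      fermionPartialTrace (PolySite.incl (Finset.erase_subset x₀ Λ))
        (cfc Real.exp (-((βh : ℂ) • (cornerEnergyRep Λ x₀ t U₁ μ + windowAnnihilator sι Λ Sw hS zw hzw O g)) +
          fermionEmbed (PolySite.incl (Finset.erase_subset x₀ Λ)) LB))).PosSemidef) :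
    ω.meanEnergy (hubbardTTPrimeFermionInteraction t 0 U) 1 ≤ ((c - βh * μ * n) - (Wnum : ℝ) / Wden) / (β - βh) := by
  obtain ⟨-, hq, -⟩ := c2Check_sound hcheck ha hb
  have hn0 : 0 ≤ n := density_nonneg_of_type ha hb hq hn
  have hβ : 0 ≤ β := (hβh.trans hlt).le
  have hKTI : ∀ (L : ℕ) [NeZero L], ∀ w : TorusSite 2 L,
      relabel (Orb.translate w) (hubbardTorusTT' L t 0 U₁ - (μ : ℂ) • totalNumber) =
        hubbardTorusTT' L t 0 U₁ - (μ : ℂ) • totalNumber := fun L _ w => by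
    rw [hubbardTorusTT'_zero_sub_mu, relabel_translate_hubbardTorusWith]
  refine h.meanEnergy_hubbardTTPrime_le_of_pressure_bounds_UCell hn0 hn2 hU hLs hβh hlt
    (fun ε hε => eventually_pressureFloor_of_c2Check_of_le_U t 0 n le_rfl hβ ha hb hcheck hn hn2 hnode hLs hε)
    (fun ε hε => ?_)
  exact eventually_log_partitionFn_sectorHamiltonianTT'_le_of_clusterCertificate t U₁ μ βh hn0 hn2 hLs hx₀ hmax hΛ
    (fun i => bondWeightSum_cornerBondWeight hx₀ (hcorner i)) (siteWeightSum_cornerSiteWeight hx₀)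
    (siteWeightSum_mul_cornerSiteWeight hx₀ (-μ)) (isHermitian_windowAnnihilator sι _ Sw hS zw hzw hO g)
    (fun L _ hL3 hℓL => trace_window_mul_windowAnnihilator (relabel_translate_gibbsDensity L (hKTI L) βh)
      _ sι Sw hS zw hzw O g) hLB hcert hε

/-- **LOWER edge on a whole `U`-cell from a checked «c2-sector» sidecar at the RIGHT end (`β`) and a corner Markov
(C1) certificate at the LEFT end at a colder `β_c > β`, every torus limit, NO transport price** (same data, the C1
certificate at `(β_c, μ, U₁)`, `0 < β < β_c`): `(Wnum/Wden − (c − β_c μ n))/(β_c − β) ≤ e_Φ(ω)` for every torus limit of the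
canonical sector Gibbs states at `(β, t, 0, U, n)`, every `U ∈ [U₁, U₂]`.
[cite: Israel1979, Lemma II.3.1] [cite: Israel1979, Thm. I.3.4] [cite: PoulinHastings2011, eqs. (3)–(8)] [cite: Ruelle1969, §3.3] -/
theorem IsTorusLimitOfMixture.le_meanEnergy_hubbardTTPrime_of_c2Check_right_of_cornerMarkovCertificate_left_UCell_allTori
    (hn2 : n ≤ 2) {U₁ U₂ : ℝ} (hU : U ∈ Set.Icc U₁ U₂)
    (h : ω.IsTorusLimitOfMixture (sectorGibbsCount n) (fun L => sectorGibbsWeightTT' β t 0 U n L)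
      (fun L => sectorGibbsVectorTT' t 0 U n L) Ls)
    (hLs : Tendsto Ls atTop atTop) (hβ : 0 < β) {βc : ℝ} (hlt : β < βc)
    -- C2 at `(β, U₂)`
    {a b : ℕ} (ha : 1 ≤ a) (hb : 1 ≤ b) {rows : List C2Row} {P K q A₀ : ℕ} {Wnum : ℤ} {Wden : ℕ}
    (hcheck : c2Check P K q A₀ a b rows Wnum Wden = true) (hn : n * ((q : ℝ) * a * b) = 2 * A₀)
    (hnode : ∀ r ∈ rows,
      r.floor ≤ (partitionFn β (spinSectorHamiltonian r.nu r.nd (hubbardOpenBoxTT' a b t 0 U₂))).re)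
    -- C1 (corner window) at `(βc, μ, U₁)`
    (μ : ℝ) {Λ : Finset (Site 2)} {x₀ : Site 2} (hx₀ : x₀ ∈ Λ) (hmax : ∀ y ∈ Λ, toLex y ≤ toLex x₀)
    (hcorner : ∀ i : Fin 2, x₀ - unitVec i ∈ Λ) {ℓw : ℕ} (hΛ : Λ ⊆ halfOpenBox 2 ℓw)
    {ι : Type*} (sι : Finset ι) (Sw : ι → Finset (Site 2)) (hS : ∀ i, Sw i ⊆ Λ) (zw : ι → Site 2)
    (hzw : ∀ i, shiftSet (zw i) (Sw i) ⊆ Λ) {O : ∀ i, FermionOp (Sw i)} (hO : ∀ i ∈ sι, (O i).IsHermitian)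
    (g : ι → ℝ) {LB : FermionOp (Λ.erase x₀)} (hLB : LB.IsHermitian) {c : ℝ}
    (hcert : ((Real.exp c : ℂ) • cfc Real.exp LB -
      fermionPartialTrace (PolySite.incl (Finset.erase_subset x₀ Λ))
        (cfc Real.exp (-((βc : ℂ) • (cornerEnergyRep Λ x₀ t U₁ μ + windowAnnihilator sι Λ Sw hS zw hzw O g)) +
          fermionEmbed (PolySite.incl (Finset.erase_subset x₀ Λ)) LB))).PosSemidef) :
    ((Wnum : ℝ) / Wden - (c - βc * μ * n)) / (βc - β) ≤ ω.meanEnergy (hubbardTTPrimeFermionInteraction t 0 U) 1 := by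
  obtain ⟨-, hq, -⟩ := c2Check_sound hcheck ha hb
  have hn0 : 0 ≤ n := density_nonneg_of_type ha hb hq hn
  have hKTI : ∀ (L : ℕ) [NeZero L], ∀ w : TorusSite 2 L,
      relabel (Orb.translate w) (hubbardTorusTT' L t 0 U₁ - (μ : ℂ) • totalNumber) =
        hubbardTorusTT' L t 0 U₁ - (μ : ℂ) • totalNumber := fun L _ w => by
    rw [hubbardTorusTT'_zero_sub_mu, relabel_translate_hubbardTorusWith]
  refine h.le_meanEnergy_hubbardTTPrime_of_pressure_bounds_UCell hn0 hn2 hU hLs hβ hlt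
    (fun ε hε => eventually_pressureFloor_of_c2Check_of_le_U t 0 n le_rfl hβ.le ha hb hcheck hn hn2 hnode hLs hε)
    (fun ε hε => ?_)
  exact eventually_log_partitionFn_sectorHamiltonianTT'_le_of_clusterCertificate t U₁ μ βc hn0 hn2 hLs hx₀ hmax hΛ
    (fun i => bondWeightSum_cornerBondWeight hx₀ (hcorner i)) (siteWeightSum_cornerSiteWeight hx₀)
    (siteWeightSum_mul_cornerSiteWeight hx₀ (-μ)) (isHermitian_windowAnnihilator sι _ Sw hS zw hzw hO g)
    (fun L _ hL3 hℓL => trace_window_mul_windowAnnihilator (relabel_translate_gibbsDensity L (hKTI L) βc)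
      _ sι Sw hS zw hzw O g) hLB hcert hε

/-! ### §2 Rectangle corollaries (`Λ = rectWindow a' b'`, corner `(a' − 1, b' − 1)`, `a', b' ≥ 2`) -/

/-- **Upper edge on a `U`-cell: sidecar at the RIGHT end `U₂` (`β`), RECTANGLE C1 at the LEFT end `U₁` (`β_h < β`), no
transport price** (`t' = 0`): `e_Φ(ω) ≤ ((c − β_h μ n) − Wnum/Wden)/(β − β_h)` for every torus limit at `(β, t, 0, U, n)`,
`U ∈ [U₁, U₂]`. [cite: Israel1979, Lemma II.3.1] [cite: Israel1979, Thm. I.3.4] [cite: PoulinHastings2011, eqs. (3)–(8)] -/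
theorem IsTorusLimitOfMixture.meanEnergy_hubbardTTPrime_le_of_c2Check_right_of_rectMarkovCertificate_left_UCell_allTori
    (hn2 : n ≤ 2) {U₁ U₂ : ℝ} (hU : U ∈ Set.Icc U₁ U₂)
    (h : ω.IsTorusLimitOfMixture (sectorGibbsCount n) (fun L => sectorGibbsWeightTT' β t 0 U n L)
      (fun L => sectorGibbsVectorTT' t 0 U n L) Ls)
    (hLs : Tendsto Ls atTop atTop) {βh : ℝ} (hβh : 0 < βh) (hlt : βh < β)
    -- C2 at `(β, U₂)`
    {a b : ℕ} (ha : 1 ≤ a) (hb : 1 ≤ b) {rows : List C2Row} {P K q A₀ : ℕ} {Wnum : ℤ} {Wden : ℕ}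
    (hcheck : c2Check P K q A₀ a b rows Wnum Wden = true) (hn : n * ((q : ℝ) * a * b) = 2 * A₀)
    (hnode : ∀ r ∈ rows,
      r.floor ≤ (partitionFn β (spinSectorHamiltonian r.nu r.nd (hubbardOpenBoxTT' a b t 0 U₂))).re)
    -- C1 (rectangle) at `(βh, μ, U₁)`
    (μ : ℝ) {a' b' : ℕ} (ha' : 2 ≤ a') (hb' : 2 ≤ b')
    {ι : Type*} (sι : Finset ι) (Sw : ι → Finset (Site 2)) (hS : ∀ i, Sw i ⊆ rectWindow a' b') (zw : ι → Site 2)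
    (hzw : ∀ i, shiftSet (zw i) (Sw i) ⊆ rectWindow a' b') {O : ∀ i, FermionOp (Sw i)}
    (hO : ∀ i ∈ sι, (O i).IsHermitian) (g : ι → ℝ)
    {LB : FermionOp ((rectWindow a' b').erase (mkSite2 (a' - 1) (b' - 1)))} (hLB : LB.IsHermitian) {c : ℝ}
    (hcert : ((Real.exp c : ℂ) • cfc Real.exp LB -
      fermionPartialTrace (PolySite.incl (Finset.erase_subset (mkSite2 (a' - 1) (b' - 1)) (rectWindow a' b')))
        (cfc Real.exp (-((βh : ℂ) • (cornerEnergyRep (rectWindow a' b') (mkSite2 (a' - 1) (b' - 1)) t U₁ μ +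
            windowAnnihilator sι (rectWindow a' b') Sw hS zw hzw O g)) +
          fermionEmbed (PolySite.incl (Finset.erase_subset (mkSite2 (a' - 1) (b' - 1)) (rectWindow a' b'))) LB))).PosSemidef) :
    ω.meanEnergy (hubbardTTPrimeFermionInteraction t 0 U) 1 ≤ ((c - βh * μ * n) - (Wnum : ℝ) / Wden) / (β - βh) :=
  h.meanEnergy_hubbardTTPrime_le_of_c2Check_right_of_cornerMarkovCertificate_left_UCell_allTori hn2 hU hLs hβh hlt
    ha hb hcheck hn hnode μ (rectCorner_mem_rectWindow (by omega) (by omega)) toLex_le_toLex_rectCorner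
    (rectCorner_sub_unitVec_mem_rectWindow ha' hb') (rectWindow_subset_halfOpenBox_max a' b') sι Sw hS zw hzw hO g
    hLB hcert

/-- **Lower edge on a `U`-cell: sidecar at the RIGHT end `U₂` (`β`), RECTANGLE C1 at the LEFT end `U₁` at `β_c > β`, no
transport price** (`t' = 0`): `(Wnum/Wden − (c − β_c μ n))/(β_c − β) ≤ e_Φ(ω)` for every torus limit at `(β, t, 0, U, n)`,
`U ∈ [U₁, U₂]`. [cite: Israel1979, Lemma II.3.1] [cite: Israel1979, Thm. I.3.4] [cite: PoulinHastings2011, eqs. (3)–(8)] -/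
theorem IsTorusLimitOfMixture.le_meanEnergy_hubbardTTPrime_of_c2Check_right_of_rectMarkovCertificate_left_UCell_allTori
    (hn2 : n ≤ 2) {U₁ U₂ : ℝ} (hU : U ∈ Set.Icc U₁ U₂)
    (h : ω.IsTorusLimitOfMixture (sectorGibbsCount n) (fun L => sectorGibbsWeightTT' β t 0 U n L)
      (fun L => sectorGibbsVectorTT' t 0 U n L) Ls)
    (hLs : Tendsto Ls atTop atTop) (hβ : 0 < β) {βc : ℝ} (hlt : β < βc)
    -- C2 at `(β, U₂)`
    {a b : ℕ} (ha : 1 ≤ a) (hb : 1 ≤ b) {rows : List C2Row} {P K q A₀ : ℕ} {Wnum : ℤ} {Wden : ℕ}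
    (hcheck : c2Check P K q A₀ a b rows Wnum Wden = true) (hn : n * ((q : ℝ) * a * b) = 2 * A₀)
    (hnode : ∀ r ∈ rows,
      r.floor ≤ (partitionFn β (spinSectorHamiltonian r.nu r.nd (hubbardOpenBoxTT' a b t 0 U₂))).re)
    -- C1 (rectangle) at `(βc, μ, U₁)`
    (μ : ℝ) {a' b' : ℕ} (ha' : 2 ≤ a') (hb' : 2 ≤ b')
    {ι : Type*} (sι : Finset ι) (Sw : ι → Finset (Site 2)) (hS : ∀ i, Sw i ⊆ rectWindow a' b') (zw : ι → Site 2)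
    (hzw : ∀ i, shiftSet (zw i) (Sw i) ⊆ rectWindow a' b') {O : ∀ i, FermionOp (Sw i)}
    (hO : ∀ i ∈ sι, (O i).IsHermitian) (g : ι → ℝ)
    {LB : FermionOp ((rectWindow a' b').erase (mkSite2 (a' - 1) (b' - 1)))} (hLB : LB.IsHermitian) {c : ℝ}
    (hcert : ((Real.exp c : ℂ) • cfc Real.exp LB -
      fermionPartialTrace (PolySite.incl (Finset.erase_subset (mkSite2 (a' - 1) (b' - 1)) (rectWindow a' b')))
        (cfc Real.exp (-((βc : ℂ) • (cornerEnergyRep (rectWindow a' b') (mkSite2 (a' - 1) (b' - 1)) t U₁ μ +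
            windowAnnihilator sι (rectWindow a' b') Sw hS zw hzw O g)) +
          fermionEmbed (PolySite.incl (Finset.erase_subset (mkSite2 (a' - 1) (b' - 1)) (rectWindow a' b'))) LB))).PosSemidef) :
    ((Wnum : ℝ) / Wden - (c - βc * μ * n)) / (βc - β) ≤ ω.meanEnergy (hubbardTTPrimeFermionInteraction t 0 U) 1 :=
  h.le_meanEnergy_hubbardTTPrime_of_c2Check_right_of_cornerMarkovCertificate_left_UCell_allTori hn2 hU hLs hβ hlt
    ha hb hcheck hn hnode μ (rectCorner_mem_rectWindow (by omega) (by omega)) toLex_le_toLex_rectCorner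
    (rectCorner_sub_unitVec_mem_rectWindow ha' hb') (rectWindow_subset_halfOpenBox_max a' b') sι Sw hS zw hzw hO g
    hLB hcert

/-! ### §3 Staircase corollaries (`Λ = stairWindow lo₁ hi₁ lo₀ hi₀`, corner `(1, hi₁ − 1)`) -/

/-- **Upper edge on a `U`-cell: sidecar at the RIGHT end `U₂` (`β`), two-row STAIRCASE C1 at the LEFT end `U₁` (`β_h < β`),
no transport price** (`t' = 0`; staircase `lo₁ + 2 ≤ hi₁`, `lo₀ + 1 ≤ hi₁ ≤ hi₀`, corner `(1, hi₁ − 1)`; e.g. the producer's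
`stair:2,2,1` = `stairWindow 0 3 0 4`): `e_Φ(ω) ≤ ((c − β_h μ n) − Wnum/Wden)/(β − β_h)` for every torus limit at
`(β, t, 0, U, n)`, `U ∈ [U₁, U₂]`. [cite: Israel1979, Lemma II.3.1] [cite: Israel1979, Thm. I.3.4] [cite: PoulinHastings2011, eqs. (3)–(8)] -/
theorem IsTorusLimitOfMixture.meanEnergy_hubbardTTPrime_le_of_c2Check_right_of_stairMarkovCertificate_left_UCell_allTori
    (hn2 : n ≤ 2) {U₁ U₂ : ℝ} (hU : U ∈ Set.Icc U₁ U₂)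
    (h : ω.IsTorusLimitOfMixture (sectorGibbsCount n) (fun L => sectorGibbsWeightTT' β t 0 U n L)
      (fun L => sectorGibbsVectorTT' t 0 U n L) Ls)
    (hLs : Tendsto Ls atTop atTop) {βh : ℝ} (hβh : 0 < βh) (hlt : βh < β)
    -- C2 at `(β, U₂)`
    {a b : ℕ} (ha : 1 ≤ a) (hb : 1 ≤ b) {rows : List C2Row} {P K q A₀ : ℕ} {Wnum : ℤ} {Wden : ℕ}
    (hcheck : c2Check P K q A₀ a b rows Wnum Wden = true) (hn : n * ((q : ℝ) * a * b) = 2 * A₀)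
    (hnode : ∀ r ∈ rows,
      r.floor ≤ (partitionFn β (spinSectorHamiltonian r.nu r.nd (hubbardOpenBoxTT' a b t 0 U₂))).re)
    -- C1 (staircase) at `(βh, μ, U₁)`
    (μ : ℝ) {lo₁ hi₁ lo₀ hi₀ : ℕ} (h₁ : lo₁ + 2 ≤ hi₁) (h₀ : lo₀ + 1 ≤ hi₁) (h₀' : hi₁ ≤ hi₀)
    {ι : Type*} (sι : Finset ι) (Sw : ι → Finset (Site 2)) (hS : ∀ i, Sw i ⊆ stairWindow lo₁ hi₁ lo₀ hi₀)
    (zw : ι → Site 2) (hzw : ∀ i, shiftSet (zw i) (Sw i) ⊆ stairWindow lo₁ hi₁ lo₀ hi₀) {O : ∀ i, FermionOp (Sw i)}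
    (hO : ∀ i ∈ sι, (O i).IsHermitian) (g : ι → ℝ)
    {LB : FermionOp ((stairWindow lo₁ hi₁ lo₀ hi₀).erase (mkSite2 1 (hi₁ - 1)))} (hLB : LB.IsHermitian) {c : ℝ}
    (hcert : ((Real.exp c : ℂ) • cfc Real.exp LB -
      fermionPartialTrace (PolySite.incl (Finset.erase_subset (mkSite2 1 (hi₁ - 1)) (stairWindow lo₁ hi₁ lo₀ hi₀)))
        (cfc Real.exp (-((βh : ℂ) • (cornerEnergyRep (stairWindow lo₁ hi₁ lo₀ hi₀) (mkSite2 1 (hi₁ - 1)) t U₁ μ +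
            windowAnnihilator sι (stairWindow lo₁ hi₁ lo₀ hi₀) Sw hS zw hzw O g)) +
          fermionEmbed (PolySite.incl (Finset.erase_subset (mkSite2 1 (hi₁ - 1)) (stairWindow lo₁ hi₁ lo₀ hi₀))) LB))).PosSemidef) :
    ω.meanEnergy (hubbardTTPrimeFermionInteraction t 0 U) 1 ≤ ((c - βh * μ * n) - (Wnum : ℝ) / Wden) / (β - βh) :=
  h.meanEnergy_hubbardTTPrime_le_of_c2Check_right_of_cornerMarkovCertificate_left_UCell_allTori hn2 hU hLs hβh hlt
    ha hb hcheck hn hnode μ (stairCorner_mem_stairWindow (by omega)) toLex_le_toLex_stairCorner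
    (stairCorner_sub_unitVec_mem_stairWindow h₁ h₀ h₀') (stairWindow_subset_halfOpenBox lo₁ hi₁ lo₀ hi₀) sι Sw hS zw
    hzw hO g hLB hcert

/-- **Lower edge on a `U`-cell: sidecar at the RIGHT end `U₂` (`β`), STAIRCASE C1 at the LEFT end `U₁` at `β_c > β`, no
transport price** (`t' = 0`): `(Wnum/Wden − (c − β_c μ n))/(β_c − β) ≤ e_Φ(ω)` for every torus limit at `(β, t, 0, U, n)`,
`U ∈ [U₁, U₂]`. [cite: Israel1979, Lemma II.3.1] [cite: Israel1979, Thm. I.3.4] [cite: PoulinHastings2011, eqs. (3)–(8)] -/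
theorem IsTorusLimitOfMixture.le_meanEnergy_hubbardTTPrime_of_c2Check_right_of_stairMarkovCertificate_left_UCell_allTori
    (hn2 : n ≤ 2) {U₁ U₂ : ℝ} (hU : U ∈ Set.Icc U₁ U₂)
    (h : ω.IsTorusLimitOfMixture (sectorGibbsCount n) (fun L => sectorGibbsWeightTT' β t 0 U n L)
      (fun L => sectorGibbsVectorTT' t 0 U n L) Ls)
    (hLs : Tendsto Ls atTop atTop) (hβ : 0 < β) {βc : ℝ} (hlt : β < βc)
    -- C2 at `(β, U₂)`
    {a b : ℕ} (ha : 1 ≤ a) (hb : 1 ≤ b) {rows : List C2Row} {P K q A₀ : ℕ} {Wnum : ℤ} {Wden : ℕ}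
    (hcheck : c2Check P K q A₀ a b rows Wnum Wden = true) (hn : n * ((q : ℝ) * a * b) = 2 * A₀)
    (hnode : ∀ r ∈ rows,
      r.floor ≤ (partitionFn β (spinSectorHamiltonian r.nu r.nd (hubbardOpenBoxTT' a b t 0 U₂))).re)
    -- C1 (staircase) at `(βc, μ, U₁)`
    (μ : ℝ) {lo₁ hi₁ lo₀ hi₀ : ℕ} (h₁ : lo₁ + 2 ≤ hi₁) (h₀ : lo₀ + 1 ≤ hi₁) (h₀' : hi₁ ≤ hi₀)
    {ι : Type*} (sι : Finset ι) (Sw : ι → Finset (Site 2)) (hS : ∀ i, Sw i ⊆ stairWindow lo₁ hi₁ lo₀ hi₀)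
    (zw : ι → Site 2) (hzw : ∀ i, shiftSet (zw i) (Sw i) ⊆ stairWindow lo₁ hi₁ lo₀ hi₀) {O : ∀ i, FermionOp (Sw i)}
    (hO : ∀ i ∈ sι, (O i).IsHermitian) (g : ι → ℝ)
    {LB : FermionOp ((stairWindow lo₁ hi₁ lo₀ hi₀).erase (mkSite2 1 (hi₁ - 1)))} (hLB : LB.IsHermitian) {c : ℝ}
    (hcert : ((Real.exp c : ℂ) • cfc Real.exp LB -
      fermionPartialTrace (PolySite.incl (Finset.erase_subset (mkSite2 1 (hi₁ - 1)) (stairWindow lo₁ hi₁ lo₀ hi₀)))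
        (cfc Real.exp (-((βc : ℂ) • (cornerEnergyRep (stairWindow lo₁ hi₁ lo₀ hi₀) (mkSite2 1 (hi₁ - 1)) t U₁ μ +
            windowAnnihilator sι (stairWindow lo₁ hi₁ lo₀ hi₀) Sw hS zw hzw O g)) +
          fermionEmbed (PolySite.incl (Finset.erase_subset (mkSite2 1 (hi₁ - 1)) (stairWindow lo₁ hi₁ lo₀ hi₀))) LB))).PosSemidef) :
    ((Wnum : ℝ) / Wden - (c - βc * μ * n)) / (βc - β) ≤ ω.meanEnergy (hubbardTTPrimeFermionInteraction t 0 U) 1 :=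
  h.le_meanEnergy_hubbardTTPrime_of_c2Check_right_of_cornerMarkovCertificate_left_UCell_allTori hn2 hU hLs hβ hlt
    ha hb hcheck hn hnode μ (stairCorner_mem_stairWindow (by omega)) toLex_le_toLex_stairCorner
    (stairCorner_sub_unitVec_mem_stairWindow h₁ h₀ h₀') (stairWindow_subset_halfOpenBox lo₁ hi₁ lo₀ hi₀) sι Sw hS zw
    hzw hO g hLB hcert

/-- **ONE ANCHOR, staircase C1: upper edge from a checked sidecar at `β` and a STAIRCASE C1 at `β_h < β`, both at the
state's own `U`, every torus limit** (the `U₁ = U₂ = U` case of the cell; `t' = 0`):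
`e_Φ(ω) ≤ ((c − β_h μ n) − Wnum/Wden)/(β − β_h)`. [cite: Israel1979, Lemma II.3.1] [cite: PoulinHastings2011, eqs. (3)–(8)] -/
theorem IsTorusLimitOfMixture.meanEnergy_hubbardTTPrime_le_of_c2Check_of_stairMarkovCertificate_allTori
    (hn2 : n ≤ 2)
    (h : ω.IsTorusLimitOfMixture (sectorGibbsCount n) (fun L => sectorGibbsWeightTT' β t 0 U n L)
      (fun L => sectorGibbsVectorTT' t 0 U n L) Ls)
    (hLs : Tendsto Ls atTop atTop) {βh : ℝ} (hβh : 0 < βh) (hlt : βh < β)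
    -- C2 at `(β, U)`
    {a b : ℕ} (ha : 1 ≤ a) (hb : 1 ≤ b) {rows : List C2Row} {P K q A₀ : ℕ} {Wnum : ℤ} {Wden : ℕ}
    (hcheck : c2Check P K q A₀ a b rows Wnum Wden = true) (hn : n * ((q : ℝ) * a * b) = 2 * A₀)
    (hnode : ∀ r ∈ rows,
      r.floor ≤ (partitionFn β (spinSectorHamiltonian r.nu r.nd (hubbardOpenBoxTT' a b t 0 U))).re)
    -- C1 (staircase) at `(βh, μ, U)`
    (μ : ℝ) {lo₁ hi₁ lo₀ hi₀ : ℕ} (h₁ : lo₁ + 2 ≤ hi₁) (h₀ : lo₀ + 1 ≤ hi₁) (h₀' : hi₁ ≤ hi₀)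
    {ι : Type*} (sι : Finset ι) (Sw : ι → Finset (Site 2)) (hS : ∀ i, Sw i ⊆ stairWindow lo₁ hi₁ lo₀ hi₀)
    (zw : ι → Site 2) (hzw : ∀ i, shiftSet (zw i) (Sw i) ⊆ stairWindow lo₁ hi₁ lo₀ hi₀) {O : ∀ i, FermionOp (Sw i)}
    (hO : ∀ i ∈ sι, (O i).IsHermitian) (g : ι → ℝ)
    {LB : FermionOp ((stairWindow lo₁ hi₁ lo₀ hi₀).erase (mkSite2 1 (hi₁ - 1)))} (hLB : LB.IsHermitian) {c : ℝ}
    (hcert : ((Real.exp c : ℂ) • cfc Real.exp LB -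
      fermionPartialTrace (PolySite.incl (Finset.erase_subset (mkSite2 1 (hi₁ - 1)) (stairWindow lo₁ hi₁ lo₀ hi₀)))
        (cfc Real.exp (-((βh : ℂ) • (cornerEnergyRep (stairWindow lo₁ hi₁ lo₀ hi₀) (mkSite2 1 (hi₁ - 1)) t U μ +
            windowAnnihilator sι (stairWindow lo₁ hi₁ lo₀ hi₀) Sw hS zw hzw O g)) +
          fermionEmbed (PolySite.incl (Finset.erase_subset (mkSite2 1 (hi₁ - 1)) (stairWindow lo₁ hi₁ lo₀ hi₀))) LB))).PosSemidef) :
    ω.meanEnergy (hubbardTTPrimeFermionInteraction t 0 U) 1 ≤ ((c - βh * μ * n) - (Wnum : ℝ) / Wden) / (β - βh) :=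
  h.meanEnergy_hubbardTTPrime_le_of_c2Check_right_of_stairMarkovCertificate_left_UCell_allTori hn2
    (Set.mem_Icc.2 ⟨le_rfl, le_rfl⟩) hLs hβh hlt ha hb hcheck hn hnode μ h₁ h₀ h₀' sι Sw hS zw hzw hO g hLB hcert

/-- **ONE ANCHOR, staircase C1: lower edge from a checked sidecar at `β` and a STAIRCASE C1 at `β_c > β`, both at the
state's own `U`** (`t' = 0`): `(Wnum/Wden − (c − β_c μ n))/(β_c − β) ≤ e_Φ(ω)`.
[cite: Israel1979, Lemma II.3.1] [cite: PoulinHastings2011, eqs. (3)–(8)] -/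
theorem IsTorusLimitOfMixture.le_meanEnergy_hubbardTTPrime_of_c2Check_of_stairMarkovCertificate_allTori
    (hn2 : n ≤ 2)
    (h : ω.IsTorusLimitOfMixture (sectorGibbsCount n) (fun L => sectorGibbsWeightTT' β t 0 U n L)
      (fun L => sectorGibbsVectorTT' t 0 U n L) Ls)
    (hLs : Tendsto Ls atTop atTop) (hβ : 0 < β) {βc : ℝ} (hlt : β < βc)
    -- C2 at `(β, U)`
    {a b : ℕ} (ha : 1 ≤ a) (hb : 1 ≤ b) {rows : List C2Row} {P K q A₀ : ℕ} {Wnum : ℤ} {Wden : ℕ}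
    (hcheck : c2Check P K q A₀ a b rows Wnum Wden = true) (hn : n * ((q : ℝ) * a * b) = 2 * A₀)
    (hnode : ∀ r ∈ rows,
      r.floor ≤ (partitionFn β (spinSectorHamiltonian r.nu r.nd (hubbardOpenBoxTT' a b t 0 U))).re)
    -- C1 (staircase) at `(βc, μ, U)`
    (μ : ℝ) {lo₁ hi₁ lo₀ hi₀ : ℕ} (h₁ : lo₁ + 2 ≤ hi₁) (h₀ : lo₀ + 1 ≤ hi₁) (h₀' : hi₁ ≤ hi₀)
    {ι : Type*} (sι : Finset ι) (Sw : ι → Finset (Site 2)) (hS : ∀ i, Sw i ⊆ stairWindow lo₁ hi₁ lo₀ hi₀)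
    (zw : ι → Site 2) (hzw : ∀ i, shiftSet (zw i) (Sw i) ⊆ stairWindow lo₁ hi₁ lo₀ hi₀) {O : ∀ i, FermionOp (Sw i)}
    (hO : ∀ i ∈ sι, (O i).IsHermitian) (g : ι → ℝ)
    {LB : FermionOp ((stairWindow lo₁ hi₁ lo₀ hi₀).erase (mkSite2 1 (hi₁ - 1)))} (hLB : LB.IsHermitian) {c : ℝ}
    (hcert : ((Real.exp c : ℂ) • cfc Real.exp LB -
      fermionPartialTrace (PolySite.incl (Finset.erase_subset (mkSite2 1 (hi₁ - 1)) (stairWindow lo₁ hi₁ lo₀ hi₀)))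
        (cfc Real.exp (-((βc : ℂ) • (cornerEnergyRep (stairWindow lo₁ hi₁ lo₀ hi₀) (mkSite2 1 (hi₁ - 1)) t U μ +
            windowAnnihilator sι (stairWindow lo₁ hi₁ lo₀ hi₀) Sw hS zw hzw O g)) +
          fermionEmbed (PolySite.incl (Finset.erase_subset (mkSite2 1 (hi₁ - 1)) (stairWindow lo₁ hi₁ lo₀ hi₀))) LB))).PosSemidef) :
    ((Wnum : ℝ) / Wden - (c - βc * μ * n)) / (βc - β) ≤ ω.meanEnergy (hubbardTTPrimeFermionInteraction t 0 U) 1 :=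
  h.le_meanEnergy_hubbardTTPrime_of_c2Check_right_of_stairMarkovCertificate_left_UCell_allTori hn2
    (Set.mem_Icc.2 ⟨le_rfl, le_rfl⟩) hLs hβ hlt ha hb hcheck hn hnode μ h₁ h₀ h₀' sι Sw hS zw hzw hO g hLB hcert

/-! ### §4 `t' ≠ 0`: the `t–t'` rectangle C1 at the left end, the sidecar at the right end -/

/-- **Upper edge on a `U`-cell at `t' ≠ 0`: sidecar at the RIGHT end `U₂` (`β`), `t–t'` RECTANGLE C1 (`cornerEnergyRepTT'`)
at the LEFT end `U₁` (`β_h < β`), every torus limit, no transport price.** Sidecar rows for the open `a × b` box at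
`(β, t, t', U₂)` passing `c2Check`, density `n (q a b) = 2 A₀`, claim node at `U₂`; C1 on `rectWindow a' b'` (`a', b' ≥ 2`) at
`(β_h, μ, t, t', U₁)`. Then for every torus limit `ω` of the canonical sector Gibbs states of `hubbardTorusTT' L t t' U` at `β`
along any `Ls → ∞`, `U ∈ [U₁, U₂]`: `e_Φ(ω) ≤ ((c − β_h μ n) − Wnum/Wden)/(β − β_h)`.
[cite: Israel1979, Lemma II.3.1] [cite: Israel1979, Thm. I.3.4] [cite: PoulinHastings2011, eqs. (3)–(8)] [cite: Ruelle1969, §3.3] -/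
theorem IsTorusLimitOfMixture.meanEnergy_hubbardTTPrime_le_of_c2Check_right_of_rectMarkovCertificateTT'_left_UCell_allTori
    (hn2 : n ≤ 2) {U₁ U₂ : ℝ} (hU : U ∈ Set.Icc U₁ U₂)
    (h : ω.IsTorusLimitOfMixture (sectorGibbsCount n) (fun L => sectorGibbsWeightTT' β t t' U n L)
      (fun L => sectorGibbsVectorTT' t t' U n L) Ls)
    (hLs : Tendsto Ls atTop atTop) {βh : ℝ} (hβh : 0 < βh) (hlt : βh < β)
    -- C2 at `(β, t, t', U₂)`
    {a b : ℕ} (ha : 1 ≤ a) (hb : 1 ≤ b) {rows : List C2Row} {P K q A₀ : ℕ} {Wnum : ℤ} {Wden : ℕ}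
    (hcheck : c2Check P K q A₀ a b rows Wnum Wden = true) (hn : n * ((q : ℝ) * a * b) = 2 * A₀)
    (hnode : ∀ r ∈ rows,
      r.floor ≤ (partitionFn β (spinSectorHamiltonian r.nu r.nd (hubbardOpenBoxTT' a b t t' U₂))).re)
    -- C1 (`t–t'` rectangle) at `(βh, μ, U₁)`
    (μ : ℝ) {a' b' : ℕ} (ha' : 2 ≤ a') (hb' : 2 ≤ b')
    {ι : Type*} (sι : Finset ι) (Sw : ι → Finset (Site 2)) (hS : ∀ i, Sw i ⊆ rectWindow a' b') (zw : ι → Site 2)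
    (hzw : ∀ i, shiftSet (zw i) (Sw i) ⊆ rectWindow a' b') {O : ∀ i, FermionOp (Sw i)}
    (hO : ∀ i ∈ sι, (O i).IsHermitian) (g : ι → ℝ)
    {LB : FermionOp ((rectWindow a' b').erase (mkSite2 (a' - 1) (b' - 1)))} (hLB : LB.IsHermitian) {c : ℝ}
    (hcert : ((Real.exp c : ℂ) • cfc Real.exp LB -
      fermionPartialTrace (PolySite.incl (Finset.erase_subset (mkSite2 (a' - 1) (b' - 1)) (rectWindow a' b')))
        (cfc Real.exp (-((βh : ℂ) • (cornerEnergyRepTT' (rectWindow a' b') (mkSite2 (a' - 1) (b' - 1)) t t' U₁ μ +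
            windowAnnihilator sι (rectWindow a' b') Sw hS zw hzw O g)) +
          fermionEmbed (PolySite.incl (Finset.erase_subset (mkSite2 (a' - 1) (b' - 1)) (rectWindow a' b'))) LB))).PosSemidef) :
    ω.meanEnergy (hubbardTTPrimeFermionInteraction t t' U) 1 ≤ ((c - βh * μ * n) - (Wnum : ℝ) / Wden) / (β - βh) := by
  obtain ⟨hnd, hq, hmS, hsum, hA, hB, hz0, harith⟩ := c2Check_sound hcheck ha hb
  have hz := c2Floor_le_of_rows hnd
    (F := fun s => (partitionFn β (spinSectorHamiltonian s.1 s.2 (hubbardOpenBoxTT' a b t t' U₂))).re)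
    (fun r hr => hnode r hr)
  have hmain := h.meanEnergy_hubbardTTPrime_le_of_typeClass_right_of_rectMarkovCertificateTT'_left_UCell_allTori hn2 hU
    hLs hβh hlt ha hb (c2Sectors rows) (c2Type rows) hq hmS hsum hA hB hn hz0 hz μ ha' hb' sι Sw hS zw hzw hO g hLB hcert
  refine hmain.trans (div_le_div_of_nonneg_right ?_ (by linarith))
  linarith

/-- **Lower edge on a `U`-cell at `t' ≠ 0`: sidecar at the RIGHT end `U₂` (`β`), `t–t'` RECTANGLE C1 at the LEFT end `U₁`
at `β_c > β`, every torus limit, no transport price**: `(Wnum/Wden − (c − β_c μ n))/(β_c − β) ≤ e_Φ(ω)` for every torus limit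
at `(β, t, t', U, n)`, `U ∈ [U₁, U₂]`. [cite: Israel1979, Lemma II.3.1] [cite: Israel1979, Thm. I.3.4] [cite: PoulinHastings2011, eqs. (3)–(8)] -/
theorem IsTorusLimitOfMixture.le_meanEnergy_hubbardTTPrime_of_c2Check_right_of_rectMarkovCertificateTT'_left_UCell_allTori
    (hn2 : n ≤ 2) {U₁ U₂ : ℝ} (hU : U ∈ Set.Icc U₁ U₂)
    (h : ω.IsTorusLimitOfMixture (sectorGibbsCount n) (fun L => sectorGibbsWeightTT' β t t' U n L)
      (fun L => sectorGibbsVectorTT' t t' U n L) Ls)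
    (hLs : Tendsto Ls atTop atTop) (hβ : 0 < β) {βc : ℝ} (hlt : β < βc)
    -- C2 at `(β, t, t', U₂)`
    {a b : ℕ} (ha : 1 ≤ a) (hb : 1 ≤ b) {rows : List C2Row} {P K q A₀ : ℕ} {Wnum : ℤ} {Wden : ℕ}
    (hcheck : c2Check P K q A₀ a b rows Wnum Wden = true) (hn : n * ((q : ℝ) * a * b) = 2 * A₀)
    (hnode : ∀ r ∈ rows,
      r.floor ≤ (partitionFn β (spinSectorHamiltonian r.nu r.nd (hubbardOpenBoxTT' a b t t' U₂))).re)
    -- C1 (`t–t'` rectangle) at `(βc, μ, U₁)`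
    (μ : ℝ) {a' b' : ℕ} (ha' : 2 ≤ a') (hb' : 2 ≤ b')
    {ι : Type*} (sι : Finset ι) (Sw : ι → Finset (Site 2)) (hS : ∀ i, Sw i ⊆ rectWindow a' b') (zw : ι → Site 2)
    (hzw : ∀ i, shiftSet (zw i) (Sw i) ⊆ rectWindow a' b') {O : ∀ i, FermionOp (Sw i)}
    (hO : ∀ i ∈ sι, (O i).IsHermitian) (g : ι → ℝ)
    {LB : FermionOp ((rectWindow a' b').erase (mkSite2 (a' - 1) (b' - 1)))} (hLB : LB.IsHermitian) {c : ℝ}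
    (hcert : ((Real.exp c : ℂ) • cfc Real.exp LB -
      fermionPartialTrace (PolySite.incl (Finset.erase_subset (mkSite2 (a' - 1) (b' - 1)) (rectWindow a' b')))
        (cfc Real.exp (-((βc : ℂ) • (cornerEnergyRepTT' (rectWindow a' b') (mkSite2 (a' - 1) (b' - 1)) t t' U₁ μ +
            windowAnnihilator sι (rectWindow a' b') Sw hS zw hzw O g)) +
          fermionEmbed (PolySite.incl (Finset.erase_subset (mkSite2 (a' - 1) (b' - 1)) (rectWindow a' b'))) LB))).PosSemidef) :
    ((Wnum : ℝ) / Wden - (c - βc * μ * n)) / (βc - β) ≤ ω.meanEnergy (hubbardTTPrimeFermionInteraction t t' U) 1 := by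
  obtain ⟨hnd, hq, hmS, hsum, hA, hB, hz0, harith⟩ := c2Check_sound hcheck ha hb
  have hz := c2Floor_le_of_rows hnd
    (F := fun s => (partitionFn β (spinSectorHamiltonian s.1 s.2 (hubbardOpenBoxTT' a b t t' U₂))).re)
    (fun r hr => hnode r hr)
  have hmain := h.le_meanEnergy_hubbardTTPrime_of_typeClass_right_of_rectMarkovCertificateTT'_left_UCell_allTori hn2 hU
    hLs hβ hlt ha hb (c2Sectors rows) (c2Type rows) hq hmS hsum hA hB hn hz0 hz μ ha' hb' sι Sw hS zw hzw hO g hLB hcert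
  refine le_trans (div_le_div_of_nonneg_right ?_ (by linarith)) hmain
  linarith

end InfVolFermionState

end Literature.MathematicalPhysics.QuantumLattice

end
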